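import Summits.AnomalousDissipation.AnomalousDissipation.Theorems.BaireTransferDenseLoudDesignerForcesLine
import Literature.Analysis.FunctionSpaces.TorusSpaceTime
import Literature.Analysis.FunctionSpaces.TorusCalculusProofs

/-!
# Stub `stub_galileanCovariance` of the line `galilean-detuning-body-force-grid`
# (crux stmt-AnomalousDissipation-1143, `BaireTransfer.DenseLoudDesignerForces`)

The exact GALILEAN COVARIANCE identity for classical Navier–Stokes solutions on `ℝ × T³`:
if `(w, q)` is a classical solution of NS_ν on `ℝ × T³` driven by the SWEPT (travelling-wave) force
`(t, y) ↦ F (y + [tV])` (`sweptForce V F`), then the Galilean boost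
`u t x = V + w t (x - [tV])` (`boost V w`) with the transported pressure `p t x = q t (x - [tV])`
(`boostScalar V q`) is a classical solution of NS_ν driven by the STEADY force `F`.

Proof (all at the time set `S = univ`): writing `a := [tV] = proj (t • V)` and `y := x - a`,
* the space–time lift of the boost is the lift of `w` composed with the affine map
  `(t, ỹ) ↦ (t, ỹ - tV)` plus a constant, whence joint smoothness;
* chain rule in time: `∂ₜu(t,x) = ∂ₜw(t,y) - Dw(t,y)[V]`;
* the space operators of `x ↦ V + w t (x - a)` are those of `w t` at `x - a`
  (`Torus.fderiv`, `laplacian`, `gradient`, `divergence`; the constant `V` is killed);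
* the convective term is `Dw(t,y)[V + w(t,y)] = Dw(t,y)[V] + (w·∇)w (t,y)`, so the cross terms
  `∓ Dw[V]` cancel and the momentum equation of `(w, q)` at `(t, y)` with force
  `F (y + a) = F x` is the momentum equation of `(u, p)` at `(t, x)` with force `F`.

References: Frisch, *Turbulence* (1995) §5.2 (Galilean invariance of Navier–Stokes); the Line module
`Theorems/BaireTransferDenseLoudDesignerForcesLine.lean` (`DenseLoudDesignerForces_of`, hypothesis `hcov`).
-/

-- `Summit.<Summit>.<Problem>` is the tree's mandated summit-side namespace (CONVENTIONS §2); for this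
-- single-conjunct summit the two coincide, so the duplicate is deliberate.
set_option linter.dupNamespace false

noncomputable section

open scoped BigOperators Topology InnerProductSpace ContDiff Laplacian
open Filter Set Function MeasureTheory

-- sub-namespace of the Line vocabulary namespace, so `sweptForce`, `boost`, `goodDrifts`, … resolve unqualified
namespace Summit.AnomalousDissipation.AnomalousDissipation.Theorems.DenseLoudDesignerForces.Galilean.Covariance

open Literature.Analysis.FunctionSpaces Literature.Analysis.FluidPDE
open Summit.AnomalousDissipation.AnomalousDissipation.Theses.BaireTransfer
open Summit.AnomalousDissipation.AnomalousDissipation.Theorems.DenseLoudDesignerForces.Negative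

/-- The flat unit torus `T³`. -/
local notation "𝕋³" => UnitAddTorus (Fin 3)
/-- Real velocity values. -/
local notation "ℝ³" => EuclideanSpace ℝ (Fin 3)
/-- Complex Fourier coefficient values. -/
local notation "ℂ³" => EuclideanSpace ℂ (Fin 3)
/-- The frequency / drift lattice `ℤ³`. -/
local notation "ℤ³" => Fin 3 → ℤ

/-! ## Space operators of `x ↦ c + g (x - a)` -/

/-- Re-centred lift of a translate: `liftAt (g (· - a)) x = liftAt g (x - a)`. [folklore] -/
theorem liftAt_comp_sub {F : Type*} (g : 𝕋³ → F) (a x : 𝕋³) :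
    Torus.liftAt (fun z => g (z - a)) x = Torus.liftAt g (x - a) := by
  funext v
  simp only [Torus.liftAt_apply, add_sub_right_comm]

/-- Re-centred lift of a constant plus a translate:
`liftAt (c + g (· - a)) x = c + liftAt g (x - a)`. [folklore] -/
theorem liftAt_const_add_comp_sub {F : Type*} [NormedAddCommGroup F] (c : F) (g : 𝕋³ → F)
    (a x : 𝕋³) :
    Torus.liftAt (fun z => c + g (z - a)) x = fun v => c + Torus.liftAt g (x - a) v := by
  funext v
  simp only [Torus.liftAt_apply, add_sub_right_comm]

/-- The torus Fréchet derivative of `x ↦ c + g (x - a)` is that of `g` at `x - a`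
(Mathlib `fderiv_const_add`, no differentiability needed). [folklore] -/
theorem fderiv_const_add_comp_sub {F : Type*} [NormedAddCommGroup F] [NormedSpace ℝ F] (c : F)
    (g : 𝕋³ → F) (a x : 𝕋³) :
    Torus.fderiv (fun z => c + g (z - a)) x = Torus.fderiv g (x - a) := by
  simp only [Torus.fderiv, liftAt_const_add_comp_sub]
  exact fderiv_const_add c

/-- The Euclidean Laplacian ignores additive constants: `Δ (c + g) = Δ g` (as `D(c + g) = Dg`
identically; no differentiability needed). [folklore] -/
theorem laplacian_const_add_fun {F : Type*} [NormedAddCommGroup F] [NormedSpace ℝ F] (c : F)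
    (g : ℝ³ → F) : Δ (fun v => c + g v) = Δ g := by
  rw [InnerProductSpace.laplacian_eq_iteratedFDeriv_stdOrthonormalBasis,
    InnerProductSpace.laplacian_eq_iteratedFDeriv_stdOrthonormalBasis]
  have h : fderiv ℝ (fun v => c + g v) = fderiv ℝ g := funext fun _ => fderiv_const_add c
  simp only [iteratedFDeriv_two_apply, h]

/-- The torus Laplacian of `x ↦ c + g (x - a)` is that of `g` at `x - a`. [folklore] -/
theorem laplacian_const_add_comp_sub {F : Type*} [NormedAddCommGroup F] [NormedSpace ℝ F] (c : F)
    (g : 𝕋³ → F) (a x : 𝕋³) :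
    Torus.laplacian (fun z => c + g (z - a)) x = Torus.laplacian g (x - a) := by
  simp only [Torus.laplacian, liftAt_const_add_comp_sub, laplacian_const_add_fun]

/-- The torus gradient of `x ↦ θ (x - a)` is that of `θ` at `x - a`. [folklore] -/
theorem gradient_comp_sub (θ : 𝕋³ → ℝ) (a x : 𝕋³) :
    Torus.gradient (fun z => θ (z - a)) x = Torus.gradient θ (x - a) := by
  simp only [Torus.gradient, liftAt_comp_sub]

/-- The torus divergence of `x ↦ c + g (x - a)` is that of `g` at `x - a`
(coordinatewise `deriv_const_add`, no differentiability needed). [folklore] -/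
theorem divergence_const_add_comp_sub (c : ℝ³) (g : 𝕋³ → ℝ³) (a x : 𝕋³) :
    Torus.divergence (fun z => c + g (z - a)) x = Torus.divergence g (x - a) := by
  simp only [Torus.divergence, Torus.partialDeriv, Torus.lineDeriv, PiLp.add_apply,
    add_sub_right_comm, deriv_const_add]

/-! ## The boost: space operators, joint smoothness, time derivative -/

/-- `(u·∇)u` of the boost: `D(w t)(y)[V + w t y] = (w·∇)w (t, y) + D(w t)(y)[V]`, `y = x - [tV]`.
[folklore] -/
theorem convect_boost (V : ℝ³) (w : ℝ → 𝕋³ → ℝ³) (t : ℝ) (x : 𝕋³) :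
    Torus.convect (boost V w t) (boost V w t) x =
      Torus.convect (w t) (w t) (x - Torus.proj (t • V)) +
        Torus.fderiv (w t) (x - Torus.proj (t • V)) V := by
  show Torus.fderiv (fun z => V + w t (z - Torus.proj (t • V))) x
      (V + w t (x - Torus.proj (t • V))) = _
  rw [fderiv_const_add_comp_sub, map_add, add_comm]
  rfl

/-- The Laplacian of the boost is the Laplacian of `w t` at `x - [tV]`. [folklore] -/
theorem laplacian_boost (V : ℝ³) (w : ℝ → 𝕋³ → ℝ³) (t : ℝ) (x : 𝕋³) :
    Torus.laplacian (boost V w t) x = Torus.laplacian (w t) (x - Torus.proj (t • V)) :=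
  laplacian_const_add_comp_sub V (w t) (Torus.proj (t • V)) x

/-- The gradient of the transported pressure is the gradient of `q t` at `x - [tV]`. [folklore] -/
theorem gradient_boostScalar (V : ℝ³) (q : ℝ → 𝕋³ → ℝ) (t : ℝ) (x : 𝕋³) :
    Torus.gradient (boostScalar V q t) x = Torus.gradient (q t) (x - Torus.proj (t • V)) :=
  gradient_comp_sub (q t) (Torus.proj (t • V)) x

/-- The divergence of the boost is the divergence of `w t` at `x - [tV]`. [folklore] -/
theorem divergence_boost (V : ℝ³) (w : ℝ → 𝕋³ → ℝ³) (t : ℝ) (x : 𝕋³) :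
    Torus.divergence (boost V w t) x = Torus.divergence (w t) (x - Torus.proj (t • V)) :=
  divergence_const_add_comp_sub V (w t) (Torus.proj (t • V)) x

/-- A field jointly smooth on `ℝ × T³` has a `C^∞` space–time lift on all of `ℝ × ℝ³`. [folklore] -/
theorem contDiff_stLift_of_univ {F : Type*} [NormedAddCommGroup F] [NormedSpace ℝ F]
    {u : ℝ → 𝕋³ → F} (hu : Torus.IsSmoothSpaceTimeOn univ u) : ContDiff ℝ ∞ (Torus.stLift u) := by
  rw [← contDiffOn_univ, ← univ_prod_univ]
  exact hu

/-- Joint smoothness of the Galilean transport `(t, x) ↦ u t (x - [tV])` of a jointly smooth field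
(its lift is `stLift u ∘ ((t, ỹ) ↦ (t, ỹ - tV))`). [folklore] -/
theorem isSmoothSpaceTimeOn_comp_sub {F : Type*} [NormedAddCommGroup F] [NormedSpace ℝ F]
    {u : ℝ → 𝕋³ → F} (hu : Torus.IsSmoothSpaceTimeOn univ u) (V : ℝ³) :
    Torus.IsSmoothSpaceTimeOn univ (fun t x => u t (x - Torus.proj (t • V))) := by
  have hst : Torus.stLift (fun t x => u t (x - Torus.proj (t • V))) =
      Torus.stLift u ∘ fun z : ℝ × ℝ³ => (z.1, z.2 - z.1 • V) := by
    funext z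
    rfl
  unfold Torus.IsSmoothSpaceTimeOn
  rw [hst, univ_prod_univ, contDiffOn_univ]
  exact (contDiff_stLift_of_univ hu).comp
    (contDiff_fst.prodMk (contDiff_snd.sub (contDiff_fst.smul contDiff_const)))

/-- The boost of a jointly smooth fluctuation is jointly smooth. [folklore] -/
theorem isSmoothSpaceTimeOn_boost {V : ℝ³} {w : ℝ → 𝕋³ → ℝ³}
    (hw : Torus.IsSmoothSpaceTimeOn univ w) : Torus.IsSmoothSpaceTimeOn univ (boost V w) :=
  (Torus.isSmoothSpaceTimeOn_const (Torus.isSmooth_const V) univ).add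
    (isSmoothSpaceTimeOn_comp_sub hw V)

/-- The transported pressure of a jointly smooth pressure is jointly smooth. [folklore] -/
theorem isSmoothSpaceTimeOn_boostScalar {V : ℝ³} {q : ℝ → 𝕋³ → ℝ}
    (hq : Torus.IsSmoothSpaceTimeOn univ q) : Torus.IsSmoothSpaceTimeOn univ (boostScalar V q) :=
  isSmoothSpaceTimeOn_comp_sub hq V

/-- **Time derivative of the boost** (chain rule along `τ ↦ (τ, ỹ - τV)`, direction `(1, -V)`):
`∂ₜ(boost V w)(t, x) = ∂ₜw(t, y) - D(w t)(y)[V]`, `y = x - [tV]`. [folklore] -/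
theorem timeDerivWithin_boost {V : ℝ³} {w : ℝ → 𝕋³ → ℝ³} (hw : Torus.IsSmoothSpaceTimeOn univ w)
    (t : ℝ) (x : 𝕋³) :
    Torus.timeDerivWithin univ (boost V w) t x =
      Torus.timeDerivWithin univ w t (x - Torus.proj (t • V)) -
        Torus.fderiv (w t) (x - Torus.proj (t • V)) V := by
  obtain ⟨y, rfl⟩ := Torus.proj_surjective x
  have hγ : HasDerivAt (fun τ : ℝ => ((τ, y - τ • V) : ℝ × ℝ³)) ((1 : ℝ), -V) t := by
    have h1 : HasDerivAt (fun τ : ℝ => y - τ • V) (-V) t := by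
      simpa using ((hasDerivAt_id t).smul_const V).const_sub y
    exact (hasDerivAt_id t).prodMk h1
  have hF : HasFDerivAt (Torus.stLift w) (fderiv ℝ (Torus.stLift w) (t, y - t • V)) (t, y - t • V) :=
    (((contDiff_stLift_of_univ hw).differentiable (by simp)) _).hasFDerivAt
  have hcomp := hF.comp_hasDerivAt t hγ
  have hfun : (fun τ => boost V w τ (Torus.proj y)) =
      fun τ => V + (Torus.stLift w ∘ fun τ : ℝ => ((τ, y - τ • V) : ℝ × ℝ³)) τ := by
    funext τ
    rfl
  have hlhs : Torus.timeDerivWithin univ (boost V w) t (Torus.proj y) =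
      fderiv ℝ (Torus.stLift w) (t, y - t • V) ((1 : ℝ), -V) := by
    unfold Torus.timeDerivWithin
    rw [derivWithin_univ, hfun, deriv_const_add, hcomp.deriv]
  have hsplit : (((1 : ℝ), -V) : ℝ × ℝ³) = ((1 : ℝ), (0 : ℝ³)) - ((0 : ℝ), V) := by
    rw [Prod.mk_sub_mk, sub_zero, zero_sub]
  have hy : Torus.proj y - Torus.proj (t • V) = Torus.proj (y - t • V) := rfl
  rw [hlhs, hsplit, map_sub, hy, hw.timeDerivWithin_apply_proj uniqueDiffOn_univ (mem_univ t),
    hw.fderiv_slice_apply (mem_univ t), univ_prod_univ, fderivWithin_univ]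

/-! ## The stub -/

/-- **Galilean covariance of classical Navier–Stokes solutions on `ℝ × T³`** (the registered stub
`stub_galileanCovariance` of the line `galilean-detuning-body-force-grid`, hypothesis `hcov` of
`DenseLoudDesignerForces_of`): a classical solution `(w, q)` of NS_ν driven by the swept force
`F (· + [tV])` boosts to the classical solution `(V + w t (· - [tV]), q t (· - [tV]))` of NS_ν driven
by the steady force `F`. [folklore] -/
theorem stub_galileanCovariance : ∀ (ν : ℝ) (V : ℝ³) (F : 𝕋³ → ℝ³) (w : ℝ → 𝕋³ → ℝ³) (q : ℝ → 𝕋³ → ℝ), Torus.IsClassicalNSSolutionOn Set.univ ν (sweptForce V F) w q → Torus.IsClassicalNSSolutionOn Set.univ ν (fun _ => F) (boost V w) (boostScalar V q) := by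
  intro ν V F w q h
  exact
    { smooth_velocity := isSmoothSpaceTimeOn_boost h.smooth_velocity
      smooth_pressure := isSmoothSpaceTimeOn_boostScalar h.smooth_pressure
      momentum := fun t _ x => by
        have hm := h.momentum t (mem_univ t) (x - Torus.proj (t • V))
        simp only [sweptForce, sub_add_cancel] at hm
        rw [timeDerivWithin_boost h.smooth_velocity, convect_boost, laplacian_boost,
          gradient_boostScalar, sub_add_add_cancel]
        exact hm
      divFree := fun t _ x => by
        rw [divergence_boost]
        exact h.divFree t (mem_univ t) _ }

end Summit.AnomalousDissipation.AnomalousDissipation.Theorems.DenseLoudDesignerForces.Galilean.Covariance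

end
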